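import Summits.QuantumFields.YangMills.Theorems.BalabanUVNodesPortU8LocUnivCurlCurl
import Literature.MathematicalPhysics.QuantumFieldTheory.Balaban1983to89.B8Eq155AbelianMultiLevelTorus

/-!
# Port piece U8 — (D1) CLAUSE 4 ROAD, STEP 2: ★★★ `abs_curlCurl_windowResp_univ_le` — THE `∂*∂` KERNEL ROW OF THE WHOLE-TORUS WINDOW RESPONSE,
# `|(∂*₁∂₁ windowResp univ l)(b)| ≤ C·η²·e^{−δ·|block_{k+1}(b₋) − l₂|_{T,∞}}` with `δ > 0`, `C ≥ 0` depending on the family `F` only (r03's [B6] (2.148)∕(2.150) rows at `d + 1 = 4`)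

Cell `ym-nodeO-ideate` ∕ `ym-balaban-port`, porter `ymgap-nodeO-port-PTB-1` (gen 4).  JOIN-side helper for **stmt-QuantumFields-27238** (K0ᴬ), `--supports … --as helper`.
[15] = [Balaban1985Variational], [B5] = [Balaban1984PropagatorsI], [B6] = [Balaban1984PropagatorsII].

WHAT IS PROVED (kernel, sorry-free).  ★★★ `abs_curlCurl_windowResp_univ_le` — `∃ δ > 0, ∃ C ≥ 0` (from r03's `B6Cor28TwoScaleV1.blockBound_QsRinv_scaling 3 F.L …`, window
`a₀ = a₁ = 1`) such that for every volume `K`, level `k` with one spare level (`k + 2 ≤ m + K`), label `l`, fine bond `b`: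
`|(dcsE 1 (dcE 1 (toLp (windowResp F k K univ l)))) b| ≤ C · eta (k+1)^2 · exp(−δ·torusSupNorm (rep (iterBlockOf (k+1) b₋) − rep l₂))` — ✓`curlCurl_windowResp_univ` ((137) in r03's
letters, step 1), r03's (2.148)∘`Q*` row and `Q*` row (`blockBound_Q_adjoint`, volume factor `η⁴` cancelled by `a = (L^{k+1})⁴`), `∂*_c∂_c = c²·∂*₁∂₁`
(✓`B8Eq155AbelianMultiLevelTorus.hodge_apply_eq_sq_mul`).  Clerical points, recorded for custody: r03's rows are stated over the LITERAL record `⟨3+1, L, m, K, _, _⟩` and carry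
the classical `DecidableEq` on bonds inside `EuclideanSpace.single`; both rows are phrased here as predicates of (record, instance), proved at the literal record with r03's
instance, normalised to this file's instance (`Subsingleton.elim`), and transported along `rfl : ⟨3+1, F.L, F.m, K, _, _⟩ = F.P K`.

HONEST FRAMING.  Bookkeeping over PROVED tree theorems (r03's [B6] Sect. C two-scale layer); the scalar `d*d` face of (‴-LocUniv) at rate `η²` for `windowResp` (`η³` for
`recordHrLocξ = η·windowResp·ρ₈` — the token-letter clause 4 is the next, purely algebraic file); clause 3 (Laplacian face) NOT touched; nothing of Bałaban's renormalization-group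
analysis asserted; K0ᴬ 27238 OPEN; NODE O 0∕1; COUNT 8∕28 · K 1∕4 UNMOVED; finite `𝕋⁴_{L^K}` at fixed ε — NOT continuum ∕ OS ∕ Clay; **the Yang–Mills mass gap (Clay) is NOT proved.**
-/

noncomputable section

open scoped BigOperators InnerProductSpace Matrix

namespace Summit.QuantumFields.YangMills.Theorems.PortU8

open Literature.MathematicalPhysics.QuantumFieldTheory.Balaban1983to89
open Literature.MathematicalPhysics.QuantumFieldTheory.Balaban1983to89.Node00
open Literature.MathematicalPhysics.QuantumFieldTheory.Balaban1983to89.T4Continuum (T4Family)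
open Literature.MathematicalPhysics.QuantumFieldTheory.Balaban1983to89.B6SectADomainsV1 (Domains)
open Literature.MathematicalPhysics.QuantumFieldTheory.BalabanImbrieJaffe1984to88.BIJ85AxialPropagator411 (BondSpace)
open Literature.MathematicalPhysics.QuantumFieldTheory.Balaban1983to89.B6SectAOperatorsV1 (BondIdx BondIdxSpace QE QsE aE dsE dcE dcsE RE QE_apply aE_apply)
open Literature.MathematicalPhysics.QuantumFieldTheory.Balaban1983to89.B6SectAVectorModelV1 (GE EE)
open Literature.MathematicalPhysics.QuantumFieldTheory.Balaban1983to89.B6SectA (hOp)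
open Literature.MathematicalPhysics.QuantumFieldTheory.Balaban1983to89.B6SectCTwoScaleV1 (twoScale CIdx OutBond InBond wPrinted)
open Literature.MathematicalPhysics.QuantumFieldTheory.Balaban1983to89.B6SectCTwoScaleV1Lattice (tsV1)
open Literature.MathematicalPhysics.QuantumFieldTheory.Balaban1983to89.B6Eq2129TwoScaleV1 (toBondIdx toBondIdx_bijective wLevel wLevel_pos)
open Literature.MathematicalPhysics.QuantumFieldTheory.Balaban1983to89.B6Eq2143TwoScaleV1 (QGQs)
open Literature.MathematicalPhysics.QuantumFieldTheory.Balaban1983to89.B6Eq235TwoScaleV1 (reindex)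
open Literature.MathematicalPhysics.QuantumFieldTheory.Balaban1983to89.B5Eq117TorusCarriers (Mk tV tB)
open Literature.MathematicalPhysics.QuantumFieldTheory.Balaban1983to89.B5Eq118OneStroke (iterBlockOf)
open Literature.MathematicalPhysics.QuantumFieldTheory.Balaban1983to89.B5Prop12FieldsLattice (distSite)
open Literature.MathematicalPhysics.QuantumFieldTheory.Balaban1983to89.B5TowerOneStroke (pullR)
open Literature.MathematicalPhysics.QuantumFieldTheory.Balaban1983to89.B5Hk163Torus (HkOp)
open Literature.MathematicalPhysics.QuantumFieldTheory.Balaban1983to89.B5HkOpLandauMin (hkT hkT_def)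
open Literature.MathematicalPhysics.QuantumFieldTheory.Balaban1983to89.B5Eq147TorusBridge (tVE tVE_symm_eq)
open Literature.MathematicalPhysics.QuantumFieldTheory.Balaban1983to89.B4TorusKernel.MultiPeriod (torusSupNorm)
open Literature.MathematicalPhysics.QuantumFieldTheory.Balaban1983to89.B6LowerBound2153Torus (rep)
open Summit.QuantumFields.YangMills.Theorems.K0RecordFormatNames
open Summit.QuantumFields.YangMills.Theorems.FlatDomainsCongr (lamBond_twoScale_empty_iff)
open Summit.QuantumFields.YangMills.Theorems.FlatHCurlCurlWhole (toLp_H_eq_hOp_twoScale_empty)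

variable (F : T4Family) {k K : ℕ}

open Classical in
/-- ★★★ **THE `∂*∂` KERNEL ROW OF THE WHOLE-TORUS WINDOW RESPONSE**: there are `δ > 0`, `C ≥ 0` depending on the family `F` only (through `L`) such that for every volume `K`,
level `k` with one spare level (`k + 2 ≤ m + K`), label `l` and fine bond `b`,
`|(∂*₁∂₁ (windowResp F k K univ l))(b)| ≤ C · η² · e^{−δ·|block_{k+1}(b₋) − l₂|_{T,∞}}`, `η = eta (k+1) = L^{−(k+1)}` — step 1's (137), r03's (2.148)∘`Q*` row
`blockBound_QsRinv_scaling` (window `a₀ = a₁ = 1` at `a = (L^{k+1})⁴`), r03's `Q*` row `blockBound_Q_adjoint` (its volume factor `η⁴` cancelled by `a`), and `∂*_c∂_c = c²·∂*₁∂₁`.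
[cite: Balaban1985Variational, (137) p.298, (190) p.308; Balaban1984PropagatorsII, (2.148)-(2.150) p.249; Balaban1984PropagatorsI, (1.63) p.28] -/
theorem abs_curlCurl_windowResp_univ_le :
    ∃ δ : ℝ, 0 < δ ∧ ∃ C : ℝ, 0 ≤ C ∧ ∀ (K k : ℕ) (hk2 : k + 1 + 1 ≤ (F.P K).m + (F.P K).K) (l : RespLabel F k K) (b : PBond (F.P K) 0),
      |dcsE 1 (dcE 1 (WithLp.toLp 2 (windowResp F k K Finset.univ l))) b| ≤
        C * (F.P K).eta (k + 1) ^ 2 *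
          Real.exp (-(δ * torusSupNorm (Mk (F.P K) (k + 1)) (rep (Mk (F.P K) (k + 1)) (iterBlockOf (k + 1) b.src) - rep (Mk (F.P K) (k + 1)) l.2))) := by
  have hd4 : 1 ≤ 3 + 1 := by norm_num
  obtain ⟨δ, hδ, C, hC, hR⟩ := B6Cor28TwoScaleV1.blockBound_QsRinv_scaling 3 F.L hd4 F.hL one_pos le_rfl
  set CQ : ℝ := Real.exp (δ + 1) * (Real.exp (δ * (2 * (F.L : ℝ) - 1)) * (2 * (3 + 1) : ℕ)) * B4Sect5Proof.latticeConst (3 + 1) 1 with hCQ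
  have hCQ0 : 0 ≤ CQ := by
    have := B4Sect5Proof.latticeConst_nonneg (3 + 1) (zero_le_one : (0 : ℝ) ≤ 1)
    positivity
  refine ⟨δ, hδ, C + CQ, add_nonneg hC hCQ0, fun K k hk2 l b => ?_⟩
  have hL0 : (0 : ℝ) < (F.L : ℝ) := by exact_mod_cast lt_trans zero_lt_one F.hL.2
  have hLc : (((F.P K).L : ℝ) ^ (k + 1)) ≠ 0 := pow_ne_zero _ (Nat.cast_ne_zero.2 (F.P K).L_pos.ne')
  set a : ℝ := (((F.P K).L : ℝ) ^ (k + 1)) ^ 4 with ha_def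
  have ha : 0 < a := by have : (0 : ℝ) < ((F.P K).L : ℝ) := Nat.cast_pos.2 (F.P K).L_pos; positivity
  -- step 1: (137) in r03's letters
  have hcc := curlCurl_windowResp_univ F hk2 l
  /- r03's two rows are stated over the literal record `⟨3+1, L, m, K, _, _⟩` (ours is `F.P K`, definitionally the same record) and carry r03's (classical) `DecidableEq`
  inside `EuclideanSpace.single`.  Both rows are phrased as predicates `Sb`, `Tb` of (record, instance): proved at the literal record with r03's instance, normalised to the
  ambient instance (`Subsingleton.elim`), transported along `rfl : ⟨3+1, …⟩ = F.P K`. -/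
  let Sb : (P : Params) → DecidableEq (CIdx (P := P) (k + 1) (∅ : Finset (Site P (k + 1 + 1)))) → Prop := fun P dI =>
    ∀ (hc : ((P.L : ℝ) ^ (k + 1)) ≠ 0) (b₀ : PBond P 0) (y : Site P (k + 1)),
      (∑ i ∈ Finset.univ.filter (fun i : CIdx (P := P) (k + 1) (∅ : Finset (Site P (k + 1 + 1))) =>
          (Sum.elim (fun o : OutBond (P := P) (k + 1) (∅ : Finset (Site P (k + 1 + 1))) => o.1.src)
            (fun b₁ : InBond (P := P) (k + 1) (∅ : Finset (Site P (k + 1 + 1))) => Site.blockSite b₁.1.src (fun _ => ⟨0, Params.L_pos _⟩)) :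
            CIdx (P := P) (k + 1) (∅ : Finset (Site P (k + 1 + 1))) → Site P (k + 1)) i = y),
        |(LinearMap.adjoint (tsV1 hc (∅ : Finset (Site P (k + 1 + 1))) (wPrinted P (k + 1) ∅ (((P.L : ℝ) ^ (k + 1)) ^ 4))).Q ∘ₗ
            Ring.inverse (QGQs hc (∅ : Finset (Site P (k + 1 + 1))) (w := wPrinted P (k + 1) ∅ (((P.L : ℝ) ^ (k + 1)) ^ 4))))
            (@EuclideanSpace.single _ ℝ _ dI i (1 : ℝ)) b₀|) ≤
        C * Real.exp (-(δ * distSite (Mk P (k + 1)) (iterBlockOf (k + 1) b₀.src) y))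
  let Tb : (P : Params) → DecidableEq (CIdx (P := P) (k + 1) (∅ : Finset (Site P (k + 1 + 1)))) → Prop := fun P dI =>
    ∀ (hc : ((P.L : ℝ) ^ (k + 1)) ≠ 0) (b₀ : PBond P 0) (y : Site P (k + 1)),
      (∑ i ∈ Finset.univ.filter (fun i : CIdx (P := P) (k + 1) (∅ : Finset (Site P (k + 1 + 1))) =>
          (Sum.elim (fun o : OutBond (P := P) (k + 1) (∅ : Finset (Site P (k + 1 + 1))) => o.1.src)
            (fun b₁ : InBond (P := P) (k + 1) (∅ : Finset (Site P (k + 1 + 1))) => Site.blockSite b₁.1.src (fun _ => ⟨0, Params.L_pos _⟩)) :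
            CIdx (P := P) (k + 1) (∅ : Finset (Site P (k + 1 + 1))) → Site P (k + 1)) i = y),
        |LinearMap.adjoint (tsV1 hc (∅ : Finset (Site P (k + 1 + 1))) (wPrinted P (k + 1) ∅ (((P.L : ℝ) ^ (k + 1)) ^ 4))).Q
            (@EuclideanSpace.single _ ℝ _ dI i (1 : ℝ)) b₀|) ≤
        P.eta (k + 1) ^ (3 + 1) * Real.exp (δ + 1) * (Real.exp (δ * (2 * (F.L : ℝ) - 1)) * (2 * (3 + 1) : ℕ)) * B4Sect5Proof.latticeConst (3 + 1) 1 *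
          Real.exp (-(δ * distSite (Mk P (k + 1)) (iterBlockOf (k + 1) b₀.src) y))
  have hP : (⟨3 + 1, F.L, F.m, K, hd4, F.hL⟩ : Params) = F.P K := rfl
  have hk2' : k + 1 + 1 ≤ F.m + K := by simpa using hk2
  -- the window `1·(L^j)⁴ ≤ wPrinted a i ≤ 1·(L^j)⁴` at `a = (L^{k+1})⁴`, `Λ′ = ∅` (over the literal record)
  have hw0 : ∀ i : CIdx (P := (⟨3 + 1, F.L, F.m, K, hd4, F.hL⟩ : Params)) (k + 1) ∅,
      1 * ((F.L : ℝ) ^ (k + 1)) ^ (3 + 1) ≤ wPrinted (⟨3 + 1, F.L, F.m, K, hd4, F.hL⟩ : Params) (k + 1) ∅ (((F.L : ℝ) ^ (k + 1)) ^ 4) i := by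
    rintro (o | i)
    · simp only [wPrinted, Sum.elim_inl, one_mul]
      norm_num
    · exact absurd i.2 (by simp)
  have hw1 : ∀ i : CIdx (P := (⟨3 + 1, F.L, F.m, K, hd4, F.hL⟩ : Params)) (k + 1) ∅,
      wPrinted (⟨3 + 1, F.L, F.m, K, hd4, F.hL⟩ : Params) (k + 1) ∅ (((F.L : ℝ) ^ (k + 1)) ^ 4) i ≤ 1 * ((F.L : ℝ) ^ (k + 1)) ^ (3 + 1) := by
    rintro (o | i)
    · simp only [wPrinted, Sum.elim_inl, one_mul]
      norm_num
    · exact absurd i.2 (by simp)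
  -- the `DecidableEq` on r03's index set carried by step 1's statement (read off by unification; all later `single`s are identified with it)
  obtain ⟨iK, hcc'⟩ : ∃ iK : DecidableEq (CIdx (P := F.P K) (k + 1) (∅ : Finset (Site (F.P K) (k + 1 + 1)))),
      dcsE (((F.P K).L : ℝ) ^ (k + 1)) (dcE (((F.P K).L : ℝ) ^ (k + 1)) (WithLp.toLp 2 (windowResp F k K Finset.univ l))) =
        (LinearMap.adjoint (tsV1 (P := F.P K) (c := ((F.P K).L : ℝ) ^ (k + 1)) (pow_ne_zero _ (Nat.cast_ne_zero.2 (F.P K).L_pos.ne'))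
              (∅ : Finset (Site (F.P K) (k + 1 + 1))) (wPrinted (F.P K) (k + 1) ∅ ((((F.P K).L : ℝ) ^ (k + 1)) ^ 4))).Q ∘ₗ
          Ring.inverse (QGQs (P := F.P K) (c := ((F.P K).L : ℝ) ^ (k + 1)) (pow_ne_zero _ (Nat.cast_ne_zero.2 (F.P K).L_pos.ne'))
            (∅ : Finset (Site (F.P K) (k + 1 + 1))) (w := wPrinted (F.P K) (k + 1) ∅ ((((F.P K).L : ℝ) ^ (k + 1)) ^ 4))))
          (@EuclideanSpace.single _ ℝ _ iK (Sum.inl ⟨⟨l.2, l.1⟩, Finset.notMem_empty _, Finset.notMem_empty _⟩) (1 : ℝ)) -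
        ((((F.P K).L : ℝ) ^ (k + 1)) ^ 4) •
          LinearMap.adjoint (tsV1 (P := F.P K) (c := ((F.P K).L : ℝ) ^ (k + 1)) (pow_ne_zero _ (Nat.cast_ne_zero.2 (F.P K).L_pos.ne'))
              (∅ : Finset (Site (F.P K) (k + 1 + 1))) (wPrinted (F.P K) (k + 1) ∅ ((((F.P K).L : ℝ) ^ (k + 1)) ^ 4))).Q
            (@EuclideanSpace.single _ ℝ _ iK (Sum.inl ⟨⟨l.2, l.1⟩, Finset.notMem_empty _, Finset.notMem_empty _⟩) (1 : ℝ)) :=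
    ⟨_, hcc⟩
  -- r03's rows at the literal record, each with r03's own instance (read off by unification)
  obtain ⟨dR, hSR⟩ : ∃ dI, Sb (⟨3 + 1, F.L, F.m, K, hd4, F.hL⟩ : Params) dI := by
    refine ⟨?_, fun hc b₀ y => ?_⟩
    rotate_left
    · dsimp only
      have h := hR F.m K (k + 1) hc hk2' (∅ : Finset (Site (⟨3 + 1, F.L, F.m, K, hd4, F.hL⟩ : Params) (k + 1 + 1)))
        (wPrinted (⟨3 + 1, F.L, F.m, K, hd4, F.hL⟩ : Params) (k + 1) ∅ (((F.L : ℝ) ^ (k + 1)) ^ 4)) hw0 hw1 b₀ y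
      rw [← B5Ineq110P12Lattice.distSite_eq_torusSupNorm] at h
      convert h using 3
  obtain ⟨dQ, hTR⟩ : ∃ dI, Tb (⟨3 + 1, F.L, F.m, K, hd4, F.hL⟩ : Params) dI := by
    refine ⟨?_, fun hc b₀ y => ?_⟩
    rotate_left
    · dsimp only
      have h := B6Cor28TwoScaleV1.blockBound_Q_adjoint (d := 3) (L := F.L) (hd := hd4) (hL := F.hL) (m := F.m) (K := K) (j := k + 1) hc
        (∅ : Finset (Site (⟨3 + 1, F.L, F.m, K, hd4, F.hL⟩ : Params) (k + 1 + 1)))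
        (w := wPrinted (⟨3 + 1, F.L, F.m, K, hd4, F.hL⟩ : Params) (k + 1) ∅ (((F.L : ℝ) ^ (k + 1)) ^ 4)) hk2' hδ.le b₀ y
      rw [← B5Ineq110P12Lattice.distSite_eq_torusSupNorm] at h
      convert h using 3
  -- transport the instance-closed rows along `rfl : ⟨3+1, F.L, F.m, K, _, _⟩ = F.P K`, then identify the transported instances with the ambient one
  have hS : ∃ dI, Sb (F.P K) dI := hP ▸ (⟨dR, hSR⟩ : ∃ dI, Sb (⟨3 + 1, F.L, F.m, K, hd4, F.hL⟩ : Params) dI)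
  have hT : ∃ dI, Tb (F.P K) dI := hP ▸ (⟨dQ, hTR⟩ : ∃ dI, Tb (⟨3 + 1, F.L, F.m, K, hd4, F.hL⟩ : Params) dI)
  obtain ⟨dK, hSK⟩ := hS
  obtain ⟨dK', hTK⟩ := hT
  have hSK' : Sb (F.P K) iK := (Subsingleton.elim dK iK) ▸ hSK
  have hTK' : Tb (F.P K) iK := (Subsingleton.elim dK' iK) ▸ hTK
  have hRb := hSK' hLc b l.2
  have hQb := hTK' hLc b l.2
  -- back to the torus sup-distance of representatives (the dimension implicit read at `F.P K`)
  have hts : distSite (d := (F.P K).d) (Mk (F.P K) (k + 1)) (iterBlockOf (k + 1) b.src) l.2 =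
      torusSupNorm (Mk (F.P K) (k + 1)) (rep (Mk (F.P K) (k + 1)) (iterBlockOf (k + 1) b.src) - rep (Mk (F.P K) (k + 1)) l.2) :=
    B5Ineq110P12Lattice.distSite_eq_torusSupNorm (Mk (F.P K) (k + 1)) _ _
  rw [hts] at hRb hQb
  -- the single index `i₀ = inl ⟨l₂, l₁⟩` is sited at `l₂`, so its term is dominated by the sited sums
  have hi₀mem : (Sum.inl ⟨⟨l.2, l.1⟩, Finset.notMem_empty _, Finset.notMem_empty _⟩ : CIdx (P := F.P K) (k + 1) ∅) ∈
      Finset.univ.filter (fun i : CIdx (P := F.P K) (k + 1) ∅ =>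
      (Sum.elim (fun o : OutBond (P := F.P K) (k + 1) ∅ => o.1.src)
        (fun b₁ : InBond (P := F.P K) (k + 1) ∅ => Site.blockSite b₁.1.src (fun _ => ⟨0, Params.L_pos _⟩)) :
        CIdx (P := F.P K) (k + 1) ∅ → Site (F.P K) (k + 1)) i = l.2) := by
    simp
  have h1 := (Finset.single_le_sum (fun i _ => abs_nonneg _) hi₀mem).trans hRb
  have h2 := mul_le_mul_of_nonneg_left ((Finset.single_le_sum (fun i _ => abs_nonneg _) hi₀mem).trans hQb) ha.le
  -- the volume factor: `a·η⁴ = 1`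
  have hvol : a * (F.P K).eta (k + 1) ^ (3 + 1) = 1 := by
    rw [ha_def]
    show (((F.P K).L : ℝ) ^ (k + 1)) ^ 4 * ((((F.P K).L : ℝ)⁻¹) ^ (k + 1)) ^ (3 + 1) = 1
    rw [show (3 + 1 : ℕ) = 4 from rfl, ← mul_pow, inv_pow, mul_inv_cancel₀ hLc, one_pow]
  have hCQeq : ∀ E : ℝ, a * ((F.P K).eta (k + 1) ^ (3 + 1) * Real.exp (δ + 1) *
      (Real.exp (δ * (2 * (F.L : ℝ) - 1)) * (2 * (3 + 1) : ℕ)) * B4Sect5Proof.latticeConst (3 + 1) 1 * E) = CQ * E := by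
    intro E
    calc a * ((F.P K).eta (k + 1) ^ (3 + 1) * Real.exp (δ + 1) * (Real.exp (δ * (2 * (F.L : ℝ) - 1)) * (2 * (3 + 1) : ℕ)) *
          B4Sect5Proof.latticeConst (3 + 1) 1 * E)
        = (a * (F.P K).eta (k + 1) ^ (3 + 1)) * (Real.exp (δ + 1) * (Real.exp (δ * (2 * (F.L : ℝ) - 1)) * (2 * (3 + 1) : ℕ)) *
          B4Sect5Proof.latticeConst (3 + 1) 1 * E) := by ring
      _ = CQ * E := by rw [hvol, one_mul, hCQ]
  -- `∂*_c∂_c = c²·∂*₁∂₁` and `c² · η² = 1`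
  have hsq := B8Eq155AbelianMultiLevelTorus.hodge_apply_eq_sq_mul (((F.P K).L : ℝ) ^ (k + 1)) (WithLp.toLp 2 (windowResp F k K Finset.univ l)) b
  have hc2 : (0 : ℝ) < (((F.P K).L : ℝ) ^ (k + 1)) ^ 2 := by positivity
  have hηc : (F.P K).eta (k + 1) ^ 2 * (((F.P K).L : ℝ) ^ (k + 1)) ^ 2 = 1 := by
    unfold Params.eta
    rw [← mul_pow, inv_pow, inv_mul_cancel₀ hLc, one_pow]
  -- the bound on `∂*_c∂_c`
  have hmain : |dcsE (((F.P K).L : ℝ) ^ (k + 1)) (dcE (((F.P K).L : ℝ) ^ (k + 1)) (WithLp.toLp 2 (windowResp F k K Finset.univ l))) b| ≤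
      (C + CQ) * Real.exp (-(δ * torusSupNorm (Mk (F.P K) (k + 1)) (rep (Mk (F.P K) (k + 1)) (iterBlockOf (k + 1) b.src) - rep (Mk (F.P K) (k + 1)) l.2))) := by
    rw [hcc', PiLp.sub_apply, PiLp.smul_apply, smul_eq_mul]
    refine (abs_sub _ _).trans ?_
    rw [abs_mul, abs_of_pos ha, add_mul]
    exact add_le_add h1 (h2.trans (le_of_eq (hCQeq _)))
  rw [hsq, abs_mul, abs_of_pos hc2] at hmain
  calc |dcsE 1 (dcE 1 (WithLp.toLp 2 (windowResp F k K Finset.univ l))) b|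
      = (F.P K).eta (k + 1) ^ 2 * ((((F.P K).L : ℝ) ^ (k + 1)) ^ 2 * |dcsE 1 (dcE 1 (WithLp.toLp 2 (windowResp F k K Finset.univ l))) b|) := by
        rw [← mul_assoc, hηc, one_mul]
    _ ≤ (F.P K).eta (k + 1) ^ 2 * ((C + CQ) * Real.exp (-(δ * torusSupNorm (Mk (F.P K) (k + 1))
          (rep (Mk (F.P K) (k + 1)) (iterBlockOf (k + 1) b.src) - rep (Mk (F.P K) (k + 1)) l.2)))) :=
        mul_le_mul_of_nonneg_left hmain (sq_nonneg _)
    _ = (C + CQ) * (F.P K).eta (k + 1) ^ 2 * Real.exp (-(δ * torusSupNorm (Mk (F.P K) (k + 1))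
          (rep (Mk (F.P K) (k + 1)) (iterBlockOf (k + 1) b.src) - rep (Mk (F.P K) (k + 1)) l.2))) := by ring

end Summit.QuantumFields.YangMills.Theorems.PortU8

end
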